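import Mathlib
-- Cheapest falsifier of stub_bulkSplit, run in-Lean: the pointwise field identity  Π = H₁/s − ½·H₂·∂ₛV₂/V₂
-- (p,q) = γ(t), (p',q') = γ'(t), Γ = p²+q², V₂ = (1 − s p)² + (s q)², ∂ₛV₂ = 2(sΓ − p).
example (s p q p' q' : ℝ) (hΓ : p ^ 2 + q ^ 2 ≠ 0) (hV : (1 - s * p) ^ 2 + (s * q) ^ 2 ≠ 0) :
    (-(q * (p * p' + q * q')) / ((p ^ 2 + q ^ 2) * ((1 - s * p) ^ 2 + (s * q) ^ 2)))
      = -(q' * (1 - s * p) + s * q * p') / ((1 - s * p) ^ 2 + (s * q) ^ 2)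
        - ((p * q' - q * p') / (p ^ 2 + q ^ 2)) * (s * (p ^ 2 + q ^ 2) - p) / ((1 - s * p) ^ 2 + (s * q) ^ 2) := by
  field_simp
  ring
-- G as defined in the bulk reps IS ∂ₜH₃ literally; and ∂ₛH₁ = G is the polynomial identity below
-- (N := s q' − s² p q' + s² q p', so H₁ = −N/V₂; ∂ₛH₁·V₂² = −(∂ₛN·V₂ − N·∂ₛV₂)).
example (s p q p' q' : ℝ) :
    -((q' - 2 * s * p * q' + 2 * s * q * p') * ((1 - s * p) ^ 2 + (s * q) ^ 2)
        - (s * q' - s ^ 2 * p * q' + s ^ 2 * q * p') * (2 * (s * (p ^ 2 + q ^ 2) - p)))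
      = (-q') * ((1 - s * p) ^ 2 + (s * q) ^ 2) + q * (-(2 * s * p' * (1 - s * p)) + 2 * s ^ 2 * q * q') := by
  ring
-- H₁(1,t) = r₁ numerator / denominator:  −[q'(1−p) + q p'] / ((1−p)² + q²)  vs crux  (−(1 − p)·q' − q·p') / ((1 − p)² + q²)
example (p q p' q' : ℝ) : -(q' * (1 - 1 * p) + 1 * q * p') = -(1 - p) * q' - q * p' := by ring
-- ½ H₃ Γ'/Γ = Π :  ½ · (−q/V₂) · (2(p p' + q q'))/Γ = −q(p p' + q q')/(Γ V₂)
example (p q p' q' V : ℝ) (hΓ : p ^ 2 + q ^ 2 ≠ 0) (hV : V ≠ 0) :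
    (1/2 : ℝ) * (-q / V) * (2 * (p * p' + q * q') / (p ^ 2 + q ^ 2)) = -(q * (p * p' + q * q')) / ((p ^ 2 + q ^ 2) * V) := by
  field_simp
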